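import Mathlib

/-!
# Duality lemma for design certificates (subfield cell of `stub_subfieldCell`, helper)

A linear system `A *ᵥ x = b` over a field is solvable as soon as one exhibits linearly independent
vectors `w i` of the LEFT kernel (`w i ᵥ* A = 0`) that are orthogonal to `b`, in number at least
`card m - rank A` (so that they span the left kernel).  This is the Fredholm alternative in the form
needed for *duality certificates* of level-one separated designs (cell dossier `SUBFIELD.md` §10.5):
for the certified `q = 4, 5` designs the left kernel of the evaluation-incidence matrix has dimension
`0–6` and a `±1` basis, so the existence of the frame functions `cf` follows from a rank bound plus a
few hundred small integers instead of megabytes of rational solution data.  Pure linear algebra;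
certificate infrastructure, NOT summit progress.
-/

namespace Summit.MatrixMultiplication.MatrixMultiplication.Theorems.GradedDesignFamily

open Matrix

/-- **Fredholm / duality certificate.**  If `w : ι → (m → K)` are linearly independent vectors in the
left kernel of `A` (`w i ᵥ* A = 0`), orthogonal to `b`, and `card m ≤ rank A + card ι`, then
`A *ᵥ x = b` has a solution. -/
theorem exists_mulVec_eq_of_leftKernel {K : Type*} [Field K] {m n ι : Type*} [Fintype m] [Fintype n]
    [DecidableEq m] [DecidableEq n] [Fintype ι]
    (A : Matrix m n K) (b : m → K) (w : ι → m → K)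
    (hrank : Fintype.card m ≤ A.rank + Fintype.card ι)
    (hw : LinearIndependent K w) (hker : ∀ i, w i ᵥ* A = 0) (hb : ∀ i, w i ⬝ᵥ b = 0) :
    ∃ x : n → K, A *ᵥ x = b := by
  classical
  set T : (m → K) →ₗ[K] (n → K) := A.vecMulLinear with hT
  have hrange : Module.finrank K (LinearMap.range T) = A.rank := by
    rw [← Matrix.rank_transpose A, Matrix.rank, Matrix.mulVecLin_transpose]
  have hrn : Module.finrank K (LinearMap.range T) + Module.finrank K (LinearMap.ker T)
      = Fintype.card m := by
    rw [LinearMap.finrank_range_add_finrank_ker, Module.finrank_fintype_fun_eq_card]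
  have hspan_le : Submodule.span K (Set.range w) ≤ LinearMap.ker T := by
    rw [Submodule.span_le]
    rintro _ ⟨i, rfl⟩
    simp [hT, hker i]
  have hspan_rank : Module.finrank K (Submodule.span K (Set.range w)) = Fintype.card ι :=
    finrank_span_eq_card hw
  have hker_eq : Submodule.span K (Set.range w) = LinearMap.ker T := by
    apply Submodule.eq_of_le_of_finrank_le hspan_le
    rw [hspan_rank]
    omega
  -- the functional `v ↦ v ⬝ᵥ b` vanishes on the left kernel
  let φ : (m → K) →ₗ[K] K :=
    { toFun := fun v => v ⬝ᵥ b
      map_add' := fun u v => add_dotProduct u v b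
      map_smul' := fun c v => by simp [smul_dotProduct] }
  have hφker : Submodule.span K (Set.range w) ≤ LinearMap.ker φ := by
    rw [Submodule.span_le]
    rintro _ ⟨i, rfl⟩
    simp [φ, hb i]
  have hφ : φ ∈ (LinearMap.ker T).dualAnnihilator := by
    rw [Submodule.mem_dualAnnihilator, ← hker_eq]
    intro v hv
    exact hφker hv
  obtain ⟨ψ, hψ⟩ : φ ∈ LinearMap.range T.dualMap := by
    rw [LinearMap.range_dualMap_eq_dualAnnihilator_ker]; exact hφ
  refine ⟨fun j => ψ (Pi.single j 1), ?_⟩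
  ext i
  have h1 : (A *ᵥ fun j => ψ (Pi.single j 1)) i = ψ (A i) := by
    have hsum : (∑ j, A i j • (Pi.single j (1 : K) : n → K)) = A i := by
      ext j'
      simp [Finset.sum_apply, Pi.single_apply]
    rw [← hsum, map_sum]
    simp [Matrix.mulVec, dotProduct, smul_eq_mul]
  have h2 : ψ (A i) = φ (Pi.single i 1) := by
    have := LinearMap.congr_fun hψ (Pi.single i 1)
    rw [LinearMap.dualMap_apply] at this
    simp only [hT, Matrix.vecMulLinear_apply, Matrix.single_one_vecMul] at this
    exact this
  rw [h1, h2]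
  simp [φ]

end Summit.MatrixMultiplication.MatrixMultiplication.Theorems.GradedDesignFamily
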